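import Literature.Probability.Percolation.CerfTwoArms
import Literature.Probability.Percolation.CerfThm11Proofs
import HarnessLib

/-!
# Cerf 2015, Theorem 1.2 (the two-arms event of a box at `p_c`): proof

Topic `Literature/Probability/Percolation`. Sorry-free discharge of the named fact
`Literature.Probability.Percolation.Cerf2015_thm_1_2` (`CerfTwoArms.lean`): R. Cerf, *A lower bound
on the two-arms exponent for critical percolation on the lattice*, Ann. Probab. 43 (2015)
2458–2480, doi:10.1214/14-AOP940 (arXiv:1306.3105; page numbers refer to the 16-page arXiv
rendering), Theorem 1.2 (p. 2): for site percolation on `ℤ^d`, `d ≥ 2`, and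
`α > (2d²+2d−2)(4d²+5d−5)/(2d²+3d−3)`, `lim_{n→∞} P_{p_c}(two-arms(Λ(n), n^α)) = 0`, where
`two-arms(Λ(n), ℓ)` is the event that two distinct open clusters of `Λ(n+ℓ)` join `Λ(n)` to
`∂ⁱⁿΛ(n+ℓ)` (`siteTwoArmsBox`).

The printed proof (§9, p. 14, last paragraph): "Theorem 1.1 and the inequality of corollary 7.2
readily imply theorem 1.2. To prove theorem 1.2, we proceed as in the proof of corollary 7.3, but
instead of the initial estimate of proposition 5.2, we use the enhanced estimate provided
by theorem 1.1", i.e. (proof of Cor. 7.3, p. 12)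
`P(two-arms(Λ(n), ℓ)) ≤ (3^{9d}/(p c)) n^{4d−2} n^{2(d−1)d} P(two-arms(0, ℓ−n))` by Cor. 7.2 with
the infimum of the connection probabilities bounded below by Lemma 6.1, and then Theorem 1.1 for
`P(two-arms(0, ℓ−n)) = O((ℓ−n)^{−γ})`, every `γ < γ_∞ = (2d²+3d−3)/(4d²+5d−5)`; with `ℓ = n^α` the
bound is `O(n^{2d²+2d−2−αγ})`, which tends to `0` for a suitable `γ < γ_∞` exactly when
`α γ_∞ > 2d²+2d−2`, the printed threshold (`cerf_threshold₂_eq`, `exists_gamma₂`).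

All three inputs are in the tree at `p_c`: Cor. 7.2 at every `p ∈ (0,1)` (`Cerf2015_cor_7_2_holds`,
`CerfCor72Proofs.lean`; proved form with `two-arms(0, ℓ−n−1)` and `ℓ ≥ n+2`, see the faithfulness
notes of `CerfTwoArms.lean`), and Lemma 6.1 / Theorem 1.1 at `p_c` (`lem_6_1_of_bound` fed with
the Hammersley input `exists_innerBoundary_siteConnIn_ge_criticalProb`, and
`Cerf2015_thm_1_1_holds`, `CerfThm11Proofs.lean`), the latter two under `0 < p_c < 1`.

## Contents

* **The critical point is positive** (`siteCriticalProb_pos`: `0 < p_c^site(ℤ^d)` in every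
  dimension, no hypothesis). `CerfThm11Proofs.lean` proves `ψ_{p_c}(S) ≥ 1` (the
  Duminil-Copin–Tassion / Hammersley finite-size criterion at `p_c`) assuming `0 < p_c < 1`, using
  differentiability of `q ↦ P_q(A)` on `(0,1)`. Here `q ↦ ψ_q(S)` is shown continuous on all of
  `ℝ` (parameter clamped to `[0,1]`; each `P_q(F_z(S))` is the polynomial `Russo.cylPoly`,
  `continuous_dctPhi_projIcc`), which gives the criterion at any `p₀ < 1` above which `θ > 0`
  (`one_le_dctPhi_of_forall_gt`), in particular at `p_c` even if `p_c = 0` — and then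
  `1 ≤ ψ_{p_c}(Λ(1)) ≤ |∂ⁱⁿΛ(1)| p_c` forces `p_c > 0` (if `p_c = 1` there is nothing to prove).
  So the only degenerate value left is `p_c = 1`, where every site is open a.s. and the two-arms
  events, which force a closed site (`siteTwoArmsBox_subset_iUnion_closed`), are null.
* **The box bound at `p_c`** (`real_siteTwoArmsBox_le_critical`): for `p_c < 1` and `γ < γ_∞`,
  `P_{p_c}(two-arms(Λ(n), ℓ)) ≤ K n^{2d²+2d−2} (ℓ−n−1)^{−γ}` for `n ≥ 1`, `ℓ ≥ n+2`.
* **`Cerf2015_thm_1_2_holds`**: with `ℓ = ⌈n^α⌉₊` and `n ≥ 4` one has `ℓ−n−1 ≥ n^α/2` (as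
  `α > 2`), so the bound is `≤ K' n^{−(αγ−2d²−2d+2)} → 0`.

## References

* R. Cerf, Ann. Probab. 43 (2015) 2458–2480, arXiv:1306.3105: Thm 1.2 (p. 2), Lemma 6.1 (p. 10),
  Cor. 7.2 and Cor. 7.3 (p. 12), §9 (p. 14) [Cerf2015].
* H. Duminil-Copin, V. Tassion, *Enseign. Math.* 62 (2016) 199–206, Thm. 1.1 item 1
  [DuminilCopinTassionEM2016].

## Mathlib / tree

Mathlib: `exists_lt_of_csInf_lt`, `ContinuousAt.eventually_lt`, `Ioo_mem_nhdsGT`,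
`continuous_projIcc`, `tendsto_rpow_neg_atTop`, `tendsto_of_tendsto_of_tendsto_of_le_of_le'`,
`Real.rpow_le_rpow_of_nonpos`. Tree: `siteTheta_eq_zero_of_dctPhi_lt_one`,
`zero_not_mem_innerBoundary_box`, `exists_innerBoundary_siteConnIn_ge_criticalProb`,
`lem_6_1_of_bound`, `Cerf2015_thm_1_1_holds` (`CerfThm11Proofs.lean`), `Cerf2015_cor_7_2_holds`
(`CerfCor72Proofs.lean`), `siteTheta_mono` (`SiteMonotonicity.lean`), `dctPhi`, `dctEvent`
(`SiteSharpnessStep.lean`), `Russo.measureReal_eq_cylPoly`, `Russo.hasDerivAt_cylPoly`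
(`RussoFormula.lean`), `cerf_exponent_eq` (`CerfSec8Proofs.lean`), `cerf_denom_pos`,
`cerfTwoArmsExponent_pos` (`CerfBoxLROProofs.lean`), `mem_siteConnIn_box_of_subset`
(`SiteConnectionTools.lean`).
-/

noncomputable section

open MeasureTheory Filter Topology Literature.Probability.LatticeModels Literature.Probability.Percolation
open scoped Finset

namespace Literature.Probability.Percolation

section CritPerc

variable {d : ℕ}

/-! ### The critical point of site percolation on `ℤ^d` is positive -/

/-- **`p ↦ ψ_p(S)` is continuous** (each `P_p(F_z(S))` is a polynomial in `p`, the event being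
determined by the finite set `I(S)`; Russo 1981, proof of Prop. 1). [folklore] -/
theorem continuous_dctPhi_projIcc {V : Type*} (G : SimpleGraph V) [DecidableEq V]
    [G.LocallyFinite] (S : Finset V) (x : V) :
    Continuous fun q : ℝ => dctPhi G (Set.projIcc 0 1 zero_le_one q) S x := by
  unfold dctPhi
  refine continuous_finsetSum _ fun z _ => ?_
  have hdet := determinedBy_dctEvent (G := G) S x z
  have heq : (fun q : ℝ => (sitePercolation V (Set.projIcc 0 1 zero_le_one q)).real
      (dctEvent G S x z)) = fun q : ℝ => Russo.cylPoly (Set.univ : Set V) (siteInterior G S)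
        (dctEvent G S x z) (Set.projIcc 0 1 zero_le_one q : ℝ) := by
    funext q
    rw [sitePercolation]
    exact Russo.measureReal_eq_cylPoly hdet Set.univ _
  rw [heq]
  have hcont : Continuous (Russo.cylPoly (Set.univ : Set V) (siteInterior G S)
      (dctEvent G S x z)) :=
    continuous_iff_continuousAt.2 fun q =>
      (Russo.hasDerivAt_cylPoly Set.univ _ _ q).continuousAt
  exact hcont.comp (continuous_subtype_val.comp continuous_projIcc)

/-- **Above `p_c` there is percolation**: `p_c^site < q` implies `θ(q) > 0` (definition of
`p_c^site` as an infimum, and monotonicity of `θ`). [folklore] -/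
theorem siteTheta_pos_of_siteCriticalProb_lt {V : Type*} [Countable V] (G : SimpleGraph V)
    [DecidableEq V] [G.LocallyFinite] (x : V) {q : unitInterval}
    (hq : siteCriticalProb G x < q) : 0 < siteTheta G x q := by
  have hne : ({p : ℝ | ∃ h : p ∈ unitInterval, 0 < siteTheta G x ⟨p, h⟩} ∪ {1}).Nonempty :=
    ⟨1, Or.inr rfl⟩
  obtain ⟨t, ht, htq⟩ := exists_lt_of_csInf_lt hne hq
  rcases ht with ⟨ht01, hθt⟩ | ht1
  · exact lt_of_lt_of_le hθt (siteTheta_mono x (show (⟨t, ht01⟩ : unitInterval) ≤ q from htq.le))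
  · rw [Set.mem_singleton_iff] at ht1
    rw [ht1] at htq
    exact absurd htq (not_lt.2 q.2.2)

/-- **Duminil-Copin–Tassion at the critical point** (site version on `ℤ^d`): if `θ(q) > 0` for
every `q ∈ (p₀, 1]` and `p₀ < 1`, then `ψ_{p₀}(S) ≥ 1` for every finite `S ∋ 0` — otherwise, by
continuity of `p ↦ ψ_p(S)`, `ψ_q(S) < 1` for some `q ∈ (p₀, 1)`, whence `θ(q) = 0`. This is the
modern form of Hammersley's finite-size criterion used in Cerf 2015, §6 (proof of Lemma 6.1:
"if the converse inequality holds, then … the system would be in the subcritical regime"); unlike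
`one_le_dctPhi_siteCriticalProb` it needs no positivity of `p₀`. [cite: Cerf2015, Lem 6.1 (proof)] -/
theorem one_le_dctPhi_of_forall_gt {p₀ : unitInterval} (hp₀ : (p₀ : ℝ) < 1)
    (hθ : ∀ q : unitInterval, (p₀ : ℝ) < q → 0 < siteTheta (zdGraph d) 0 q)
    {S : Finset (Site d)} (h0S : (0 : Site d) ∈ S) : 1 ≤ dctPhi (zdGraph d) p₀ S 0 := by
  by_contra hlt
  rw [not_le] at hlt
  set f : ℝ → ℝ := fun q => dctPhi (zdGraph d) (Set.projIcc 0 1 zero_le_one q) S 0 with hf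
  have hfc : Continuous f := continuous_dctPhi_projIcc (zdGraph d) S 0
  have hfp₀ : f p₀ < 1 := by
    simp only [hf, Set.projIcc_val]
    exact hlt
  have hev : ∀ᶠ q in 𝓝 (p₀ : ℝ), f q < 1 :=
    hfc.continuousAt.eventually_lt continuousAt_const hfp₀
  have hev' : ∀ᶠ q in 𝓝[>] (p₀ : ℝ), f q < 1 ∧ q ∈ Set.Ioo (p₀ : ℝ) 1 :=
    (hev.filter_mono nhdsWithin_le_nhds).and (Ioo_mem_nhdsGT hp₀)
  obtain ⟨q, hq, hqI⟩ := hev'.exists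
  have hq01 : q ∈ unitInterval := ⟨p₀.2.1.trans hqI.1.le, hqI.2.le⟩
  have hθq := hθ ⟨q, hq01⟩ hqI.1
  have hproj : Set.projIcc 0 1 zero_le_one q = ⟨q, hq01⟩ := Set.projIcc_of_mem _ hq01
  have hψ : dctPhi (zdGraph d) ⟨q, hq01⟩ S 0 < 1 := by
    have : f q < 1 := hq
    simp only [hf, hproj] at this
    exact this
  have h0 := siteTheta_eq_zero_of_dctPhi_lt_one ⟨q, hq01⟩ h0S hψ
  rw [h0] at hθq
  exact lt_irrefl _ hθq

/-- For `z ≠ x`, `F_z(S) ⊆ {x open}`, so `P_p(F_z(S)) ≤ p`. [folklore] -/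
theorem real_dctEvent_le {V : Type*} (G : SimpleGraph V) [DecidableEq V] [G.LocallyFinite]
    (p : unitInterval) {S : Finset V} {x z : V} (hzx : z ≠ x) :
    (sitePercolation V p).real (dctEvent G S x z) ≤ p := by
  rw [← sitePercolation_real_mem p x]
  refine measureReal_mono (fun ω hω => ?_) (measure_ne_top _ _)
  rcases hω with h | ⟨w, -, hw⟩
  · exact absurd h hzx
  · exact hw.1

/-- **`p_c^site(ℤ^d) > 0`** (Hammersley's lower bound in its weakest form; cf. Cerf 2015, §6,
where `p_c ∈ ]0,1[` is a standing assumption): if `p_c = 1` there is nothing to prove; if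
`p_c < 1` then `1 ≤ ψ_{p_c}(Λ(1)) = Σ_{z ∈ ∂ⁱⁿΛ(1)} P_{p_c}(F_z(Λ(1))) ≤ |∂ⁱⁿΛ(1)| · p_c`, each
`F_z(Λ(1))`, `z ≠ 0`, forcing the origin to be open. (The classical bound is `p_c ≥ 1/(2d−1)`
by path counting; only positivity is needed here.) [folklore] -/
theorem siteCriticalProb_pos : 0 < siteCriticalProb (zdGraph d) (0 : Site d) := by
  set p := siteCriticalProbI d with hp
  change 0 < (p : ℝ)
  rcases eq_or_lt_of_le p.2.2 with hp1 | hp1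
  · rw [hp1]; exact one_pos
  have hψ := one_le_dctPhi_of_forall_gt hp1
    (fun _ hq => siteTheta_pos_of_siteCriticalProb_lt (zdGraph d) 0 hq) (zero_mem_box d 1)
  have hle : dctPhi (zdGraph d) p (box d 1) 0 ≤
      (innerBoundary (zdGraph d) (box d 1)).card * (p : ℝ) := by
    unfold dctPhi
    rw [← nsmul_eq_mul, ← Finset.sum_const]
    refine Finset.sum_le_sum fun z hz => real_dctEvent_le (zdGraph d) p ?_
    rintro rfl
    exact zero_not_mem_innerBoundary_box le_rfl hz
  by_contra h0
  have hp0 : (p : ℝ) = 0 := le_antisymm (not_lt.1 h0) p.2.1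
  rw [hp0, mul_zero] at hle
  linarith

/-! ### Theorem 1.2 at the critical point -/

/-- In `two-arms(Λ(n), ℓ)` some site of `Λ(n+ℓ)` is closed (if all were open, the clusters of
`a` and `b` in `Λ(n+ℓ)` would coincide). [cite: Cerf2015, §7] -/
theorem siteTwoArmsBox_subset_iUnion_closed (n ℓ : ℕ) :
    siteTwoArmsBox d n ℓ ⊆ ⋃ z ∈ box d (n + ℓ), {ω : SiteConfig (Site d) | z ∉ ω} := by
  intro ω hω
  obtain ⟨a, ha, b, hb, hdisj, -, ⟨wb, -, hwb⟩⟩ := hω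
  simp only [Set.mem_iUnion, Set.mem_setOf_eq, exists_prop]
  by_contra hall
  push Not at hall
  have hsub : box d n ⊆ box d (n + ℓ) := box_mono d (Nat.le_add_right n ℓ)
  have hω' : (↑(box d (n + ℓ)) : Set (Site d)) ⊆ ω := fun z hz => hall z (Finset.mem_coe.1 hz)
  have hab : b ∈ siteClusterIn (zdGraph d) ↑(box d (n + ℓ)) ω a :=
    mem_siteConnIn_box_of_subset (n + ℓ) (hsub ha) (hsub hb) hω'
  have hbb : b ∈ siteClusterIn (zdGraph d) ↑(box d (n + ℓ)) ω b := root_mem_siteClusterIn hwb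
  exact Set.disjoint_left.1 hdisj hab hbb

/-- `P_p(two-arms(Λ(n), ℓ)) ≤ |Λ(n+ℓ)| (1 − p)`; in particular the event is null at `p = 1`.
[cite: Cerf2015, §7] -/
theorem real_siteTwoArmsBox_le (p : unitInterval) (n ℓ : ℕ) :
    (sitePercolation (Site d) p).real (siteTwoArmsBox d n ℓ) ≤ (box d (n + ℓ)).card * (1 - p) := by
  calc (sitePercolation (Site d) p).real (siteTwoArmsBox d n ℓ)
      ≤ (sitePercolation (Site d) p).real
          (⋃ z ∈ box d (n + ℓ), {ω : SiteConfig (Site d) | z ∉ ω}) :=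
        measureReal_mono (siteTwoArmsBox_subset_iUnion_closed n ℓ) (measure_ne_top _ _)
    _ ≤ ∑ z ∈ box d (n + ℓ), (sitePercolation (Site d) p).real {ω : SiteConfig (Site d) | z ∉ ω} :=
        measureReal_biUnion_finset_le _ _
    _ = (box d (n + ℓ)).card * (1 - p) := by
        simp only [sitePercolation_real_notMem, Finset.sum_const, nsmul_eq_mul]

/-- **The box two-arms bound at `p_c`** (Cerf 2015, §9, p. 14: "Theorem 1.1 and the inequality
of corollary 7.2 readily imply theorem 1.2 … instead of the initial estimate of proposition 5.2,
we use the enhanced estimate provided by theorem 1.1"): for `p_c < 1` and `γ < γ_∞` there is `K`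
with `P_{p_c}(two-arms(Λ(n), ℓ)) ≤ K n^{2d²+2d−2} (ℓ−n−1)^{−γ}` for `n ≥ 1`, `ℓ ≥ n + 2`
(Cor. 7.2, Lemma 6.1 at `p_c` for the infimum, Theorem 1.1 at `p_c`; `0 < p_c` by `siteCriticalProb_pos`).
[cite: Cerf2015, Thm 1.2 (proof, §9 p. 14)] -/
theorem real_siteTwoArmsBox_le_critical (hd : 2 ≤ d)
    (hpc : siteCriticalProb (zdGraph d) (0 : Site d) < 1) {γ : ℝ}
    (hγ : γ < cerfTwoArmsExponent d) :
    ∃ K : ℝ, ∀ n : ℕ, 1 ≤ n → ∀ ℓ : ℕ, n + 2 ≤ ℓ →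
      (sitePercolation (Site d) (siteCriticalProbI d)).real (siteTwoArmsBox d n ℓ) ≤
        K * (n : ℝ) ^ (2 * d ^ 2 + 2 * d - 2) * ((ℓ - n - 1 : ℕ) : ℝ) ^ (-γ) := by
  set p := siteCriticalProbI d with hp
  set μ := sitePercolation (Site d) p with hμ
  have hd1 : 1 ≤ d := by omega
  have hp0 : 0 < (p : ℝ) := siteCriticalProb_pos
  have hp1 : (p : ℝ) < 1 := hpc
  obtain ⟨C₇, hC₇⟩ := Cerf2015_cor_7_2_holds d hd p hp0 hp1
  have hκ : ∀ m : ℕ, 1 ≤ m → ∃ b ∈ innerBoundary (zdGraph d) (box d m),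
      (p : ℝ) / (2 * d * (2 * m + 1) ^ (d - 1)) ≤
        μ.real (siteConnIn (zdGraph d) ↑(box d m) 0 b) :=
    fun m hm => exists_innerBoundary_siteConnIn_ge_criticalProb hp0 hp1 hm
  obtain ⟨c₆, hc₆, h6⟩ := lem_6_1_of_bound hd p hp0 hp0 (le_of_lt hp1) hκ
  obtain ⟨c₁, hc₁⟩ := Cerf2015_thm_1_1_holds d hd γ hγ
  set C₇' := max C₇ 0 with hC₇'
  set c₁' := max c₁ 0 with hc₁'
  refine ⟨C₇' * c₁' / c₆, fun n hn ℓ hℓ => ?_⟩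
  have hn0 : (0 : ℝ) < n := by exact_mod_cast hn
  set q : ℝ := c₆ / (n : ℝ) ^ (2 * (d - 1) * d) with hq
  have hqpos : 0 < q := by positivity
  have h6n : ∀ a ∈ innerBoundary (zdGraph d) (box d n), ∀ b ∈ innerBoundary (zdGraph d) (box d n),
      q ≤ μ.real (siteConnIn (zdGraph d) ↑(box d (2 * n)) a b) :=
    fun a ha b hb => h6 n hn a (mem_innerBoundary_iff.1 ha).1 b (mem_innerBoundary_iff.1 hb).1
  have h72 := hC₇ n hn ℓ hℓ q h6n
  set m : ℕ := ℓ - n - 1 with hm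
  have hm1 : 1 ≤ m := by omega
  have hm0 : (0 : ℝ) < m := by exact_mod_cast hm1
  have h11 := hc₁ m hm1
  have hrpow : 0 ≤ (m : ℝ) ^ (-γ) := Real.rpow_nonneg hm0.le _
  have hX : μ.real (siteTwoArmsBox d n ℓ) * q ≤
      C₇' * (n : ℝ) ^ (4 * d - 2) * (c₁' * (m : ℝ) ^ (-γ)) :=
    calc μ.real (siteTwoArmsBox d n ℓ) * q
        ≤ C₇ * (n : ℝ) ^ (4 * d - 2) * μ.real (siteTwoArms d 0 m) := h72
      _ ≤ C₇' * (n : ℝ) ^ (4 * d - 2) * μ.real (siteTwoArms d 0 m) :=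
          mul_le_mul_of_nonneg_right (mul_le_mul_of_nonneg_right (le_max_left _ _)
            (by positivity)) measureReal_nonneg
      _ ≤ C₇' * (n : ℝ) ^ (4 * d - 2) * (c₁' * (m : ℝ) ^ (-γ)) := by
          apply mul_le_mul_of_nonneg_left _ (by positivity)
          exact h11.trans (mul_le_mul_of_nonneg_right (le_max_left _ _) hrpow)
  have hpow : (n : ℝ) ^ (4 * d - 2) * (n : ℝ) ^ (2 * (d - 1) * d) =
      (n : ℝ) ^ (2 * d ^ 2 + 2 * d - 2) := by
    rw [← pow_add, cerf_exponent_eq hd1]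
  rw [← le_div_iff₀ hqpos] at hX
  have heq : C₇' * (n : ℝ) ^ (4 * d - 2) * (c₁' * (m : ℝ) ^ (-γ)) / q =
      C₇' * c₁' / c₆ * ((n : ℝ) ^ (4 * d - 2) * (n : ℝ) ^ (2 * (d - 1) * d)) * (m : ℝ) ^ (-γ) := by
    simp only [hq]
    field_simp
  rw [heq, hpow] at hX
  exact hX

/-- The threshold of Theorem 1.2, `T₂(d) = (2d²+2d−2)(4d²+5d−5)/(2d²+3d−3)`, equals
`(2d²+2d−2)/γ_∞`. [cite: Cerf2015, Thm 1.2] -/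
theorem cerf_threshold₂_eq (hd : 1 ≤ d) :
    (2 * (d : ℝ) ^ 2 + 2 * d - 2) * (4 * (d : ℝ) ^ 2 + 5 * d - 5) /
        (2 * (d : ℝ) ^ 2 + 3 * d - 3) =
      (2 * (d : ℝ) ^ 2 + 2 * d - 2) / cerfTwoArmsExponent d := by
  obtain ⟨h1, h2⟩ := cerf_denom_pos hd
  unfold cerfTwoArmsExponent
  field_simp

/-- `T₂(d) > 2` for `d ≥ 1`. [folklore] -/
theorem two_lt_cerf_threshold₂ (hd : 1 ≤ d) :
    2 < (2 * (d : ℝ) ^ 2 + 2 * d - 2) * (4 * (d : ℝ) ^ 2 + 5 * d - 5) /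
      (2 * (d : ℝ) ^ 2 + 3 * d - 3) := by
  obtain ⟨h1, h2⟩ := cerf_denom_pos hd
  have hd' : (1 : ℝ) ≤ d := by exact_mod_cast hd
  rw [lt_div_iff₀ h1]
  have h3 : (2 : ℝ) ≤ 2 * (d : ℝ) ^ 2 + 2 * d - 2 := by nlinarith
  nlinarith

/-- Choice of the two-arms exponent `γ ∈ [0, γ_∞)` with `α γ > 2d²+2d−2`, possible exactly when
`α > T₂(d)` (Cerf 2015, Thm 1.2: "Let `α` be such that `α > (2d²+2d−2)(4d²+5d−5)/(2d²+3d−3)`").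
[cite: Cerf2015, Thm 1.2] -/
theorem exists_gamma₂ (hd : 1 ≤ d) {α : ℝ}
    (hα : (2 * (d : ℝ) ^ 2 + 2 * d - 2) * (4 * (d : ℝ) ^ 2 + 5 * d - 5) /
      (2 * (d : ℝ) ^ 2 + 3 * d - 3) < α) :
    ∃ γ : ℝ, 0 ≤ γ ∧ γ < cerfTwoArmsExponent d ∧ 2 * (d : ℝ) ^ 2 + 2 * d - 2 < α * γ := by
  have hγ := cerfTwoArmsExponent_pos hd
  have hT := two_lt_cerf_threshold₂ hd
  rw [cerf_threshold₂_eq hd] at hα hT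
  have hαpos : 0 < α := by linarith
  have hd' : (1 : ℝ) ≤ d := by exact_mod_cast hd
  set E : ℝ := 2 * (d : ℝ) ^ 2 + 2 * d - 2 with hE
  have hE0 : 0 < E := by rw [hE]; nlinarith
  have hkey : E / α < cerfTwoArmsExponent d := by
    rw [div_lt_iff₀ hαpos]
    rw [div_lt_iff₀ hγ] at hα
    linarith [mul_comm α (cerfTwoArmsExponent d)]
  refine ⟨(E / α + cerfTwoArmsExponent d) / 2, ?_, ?_, ?_⟩
  · have : 0 ≤ E / α := div_nonneg hE0.le hαpos.le
    linarith
  · linarith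
  · have h1 : α * ((E / α + cerfTwoArmsExponent d) / 2) =
        (E + α * cerfTwoArmsExponent d) / 2 := by
      field_simp
    rw [h1]
    have : E < α * cerfTwoArmsExponent d := by
      have := (div_lt_iff₀ hαpos).1 hkey
      linarith [mul_comm α (cerfTwoArmsExponent d)]
    linarith

/-- **Cerf 2015, Theorem 1.2, discharged**: "Let `d ≥ 2` and let `p_c` be the critical probability
of the site percolation model in `d` dimensions. Let `α` be such that
`α > (2d²+2d−2)(4d²+5d−5)/(2d²+3d−3)`. We have `lim_{n→∞} P_{p_c}(two-arms(Λ(n), n^α)) = 0`"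
(with `n^α ↦ ⌈n^α⌉₊`). Proof as printed (§9, p. 14): Cor. 7.2 with Lemma 6.1 at `p_c` and
Theorem 1.1 at `p_c` give `P ≤ K n^{2d²+2d−2} (⌈n^α⌉−n−1)^{−γ} = O(n^{2d²+2d−2−αγ}) → 0` for a
`γ < γ_∞` with `αγ > 2d²+2d−2`; if `p_c = 1` the events are null. [cite: Cerf2015, Thm 1.2] -/
theorem Cerf2015_thm_1_2_holds : Cerf2015_thm_1_2 := by
  intro d hd α hα
  set p := siteCriticalProbI d with hp
  set μ := sitePercolation (Site d) p with hμ
  have hd1 : 1 ≤ d := by omega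
  rcases eq_or_lt_of_le p.2.2 with hp1 | hp1
  · -- `p_c = 1`: the two-arms events are null
    have h0 : ∀ n : ℕ, μ.real (siteTwoArmsBox d n ⌈(n : ℝ) ^ α⌉₊) = 0 := fun n => by
      refine le_antisymm ?_ measureReal_nonneg
      have h := real_siteTwoArmsBox_le (d := d) p n ⌈(n : ℝ) ^ α⌉₊
      rw [hp1, sub_self, mul_zero] at h
      exact h
    have hfun : (fun n : ℕ => μ.real (siteTwoArmsBox d n ⌈(n : ℝ) ^ α⌉₊)) = fun _ => 0 :=
      funext h0
    rw [hfun]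
    exact tendsto_const_nhds
  · have hpc : siteCriticalProb (zdGraph d) (0 : Site d) < 1 := hp1
    obtain ⟨γ, hγ0, hγ, hαγ⟩ := exists_gamma₂ hd1 hα
    obtain ⟨K, hK⟩ := real_siteTwoArmsBox_le_critical hd hpc hγ
    have hα2 : 2 ≤ α := by linarith [two_lt_cerf_threshold₂ hd1]
    have h2e : 2 ≤ 2 * d ^ 2 + 2 * d := by nlinarith
    set e : ℕ := 2 * d ^ 2 + 2 * d - 2 with he
    have hecast : (e : ℝ) = 2 * (d : ℝ) ^ 2 + 2 * d - 2 := by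
      rw [he, Nat.cast_sub h2e]; push_cast; ring
    set ε : ℝ := α * γ - (2 * (d : ℝ) ^ 2 + 2 * d - 2) with hε
    have hεpos : 0 < ε := by rw [hε]; linarith
    set K' : ℝ := max K 0 * (2 : ℝ) ^ γ with hK'
    have hg : Tendsto (fun n : ℕ => K' * (n : ℝ) ^ (-ε)) atTop (𝓝 0) := by
      have := ((tendsto_rpow_neg_atTop hεpos).comp tendsto_natCast_atTop_atTop).const_mul K'
      rw [mul_zero] at this
      exact this
    refine tendsto_of_tendsto_of_tendsto_of_le_of_le' tendsto_const_nhds hg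
      (Eventually.of_forall fun n => measureReal_nonneg) ?_
    rw [eventually_atTop]
    refine ⟨4, fun n hn => ?_⟩
    have hn1 : 1 ≤ n := by omega
    have hn0 : (0 : ℝ) < n := by exact_mod_cast (show 0 < n by omega)
    have hn1r : (1 : ℝ) ≤ n := by exact_mod_cast hn1
    have hn4 : (4 : ℝ) ≤ n := by exact_mod_cast hn
    have hnα : 2 * (n : ℝ) + 4 ≤ (n : ℝ) ^ α := by
      have h1 : (n : ℝ) ^ (2 : ℝ) ≤ (n : ℝ) ^ α := Real.rpow_le_rpow_of_exponent_le hn1r hα2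
      rw [Real.rpow_two] at h1
      have h2 : 4 * (n : ℝ) ≤ (n : ℝ) ^ 2 := by nlinarith
      linarith
    set ℓ : ℕ := ⌈(n : ℝ) ^ α⌉₊ with hℓ
    have hℓge : (n : ℝ) ^ α ≤ ℓ := Nat.le_ceil _
    have hℓn : n + 2 ≤ ℓ := by
      have : (n : ℝ) + 2 ≤ (ℓ : ℝ) := by linarith
      exact_mod_cast this
    set m : ℕ := ℓ - n - 1 with hm
    have hmcast : (m : ℝ) = (ℓ : ℝ) - n - 1 := by
      have h1 : n + 1 + m = ℓ := by omega
      have h2 := congrArg (Nat.cast (R := ℝ)) h1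
      push_cast at h2
      linarith
    have hmge : (n : ℝ) ^ α / 2 ≤ m := by rw [hmcast]; linarith
    have hαpos : 0 < (n : ℝ) ^ α / 2 := by positivity
    have hm_rpow : (m : ℝ) ^ (-γ) ≤ ((n : ℝ) ^ α / 2) ^ (-γ) :=
      Real.rpow_le_rpow_of_nonpos hαpos hmge (by linarith)
    have hsplit : ((n : ℝ) ^ α / 2) ^ (-γ) = (2 : ℝ) ^ γ * (n : ℝ) ^ (-(α * γ)) := by
      rw [Real.div_rpow (Real.rpow_nonneg hn0.le _) zero_le_two, ← Real.rpow_mul hn0.le,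
        Real.rpow_neg zero_le_two, show α * -γ = -(α * γ) by ring, div_inv_eq_mul]
      exact mul_comm _ _
    have hKn := hK n hn1 ℓ hℓn
    calc μ.real (siteTwoArmsBox d n ℓ)
        ≤ K * (n : ℝ) ^ e * (m : ℝ) ^ (-γ) := hKn
      _ ≤ max K 0 * (n : ℝ) ^ e * (m : ℝ) ^ (-γ) :=
          mul_le_mul_of_nonneg_right (mul_le_mul_of_nonneg_right (le_max_left K 0)
            (by positivity)) (Real.rpow_nonneg (Nat.cast_nonneg m) _)
      _ ≤ max K 0 * (n : ℝ) ^ e * ((2 : ℝ) ^ γ * (n : ℝ) ^ (-(α * γ))) := by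
          rw [← hsplit]
          exact mul_le_mul_of_nonneg_left hm_rpow (by positivity)
      _ = K' * ((n : ℝ) ^ (e : ℝ) * (n : ℝ) ^ (-(α * γ))) := by
          rw [Real.rpow_natCast]; simp only [hK']; ring
      _ = K' * (n : ℝ) ^ (-ε) := by
          rw [← Real.rpow_add hn0, hecast]
          congr 1; congr 1
          rw [hε]; ring

end CritPerc

end Literature.Probability.Percolation
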